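import Mathlib
import HarnessLib
import Summits.Ventures.LatticeQCDFlow.Exactness.NCMCGeneralSpaceTwoSampleBlocksCLT

/-!
# Unequal sample sizes, II: the free-energy estimate from `a·n` forward and `b·n` reverse evolutions

HONEST FRAMING: exact (Metropolis-corrected) sampling algorithms for lattice gauge theory;
figures of merit are autocorrelation/cost numbers at stated couplings and volumes; no
continuum-physics claim.

Venture `LatticeQCDFlow` (cell pub-lqcd), topic `Exactness`; FANOUT row 13 (`eng-snf`, GEN-14).
NEW WORK of the cell (elementary asymptotic statistics: the strong law and the delta method for
`log`, both already in the cell's files), not a published result; nothing is cited as a fact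
(C. H. Bennett 1976 named only).  Continuation of `NCMCGeneralSpaceTwoSampleBlocksCLT.lean`
(GEN-14: `√n (R_n − e^{−ΔF}) →d N(0, e^{−2ΔF} V_{a,b}(α))` for the two-sample estimator over blocks
of `a` forward and `b` reverse evolutions) — here the `−log` step, as GEN-12's
`NCMCGeneralSpaceTwoSampleCLT.lean` did for `a = b = 1`.

## Setting and content

A Crooks pair `(κF, κR, s, e, W)` from `ν₀` to `ν₁` with `e^{−ΔF} = Z₁/Z₀`, a positive measurable
statistic `α` with `α e^{−W} ∈ L²(P_F)`, `α ∈ L²(P_R)`, block sizes `a, b ≥ 1`, the run of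
independent blocks `ω : ℕ → (Fin a → E) × (Fin b → E)` under `Measure.infinitePi (fun _ => P_F^{⊗a} ⊗ P_R^{⊗b})`,
`R_n` the two-sample estimator of `e^{−ΔF}` from the first `n` blocks (`a·n` forward, `b·n` reverse
evolutions), `ΔF̂_n = −log R_n`, and
`V_{a,b}(α) = (E_F[(α e^{−W})²]/E_F[α e^{−W}]² − 1)/a + (E_R[α²]/E_R[α]² − 1)/b`.

* **`CrooksPair.tendsto_twoSample_ratio_blocks_ae`** — CONSISTENCY: `R_n → e^{−ΔF}` almost surely
  (the strong law for the two block sums).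
* **`CrooksPair.tendstoInDistribution_twoSample_freeEnergy_blocks`** —
  `√n (ΔF̂_n − ΔF) →d N(0, V_{a,b}(α))`: BENNETT'S FUNCTIONAL WITH `nf = a`, `nr = b` IS THE
  ASYMPTOTIC VARIANCE per block, i.e. `Var(ΔF̂) ≈ (E_F[(αe^{−W})²]/E_F[αe^{−W}]² − 1)/nf + (E_R[α²]/E_R[α]² − 1)/nr`
  with `nf = a·n`, `nr = b·n` total evolutions — the formula of Bennett's paper for arbitrary sample
  sizes in a fixed ratio; with GEN-11's `bennett_lower_bound` the Fermi weight at the right constant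
  minimises it.
  Reading for the engine (`estimators.bar`, `twosided` with `n_forward ≠ n_reverse`): the honest
  large-sample error bar of the two-sample free-energy estimate is
  `√((1/ESS_F − 1)/nf + (1/ESS_R − 1)/nr)` in population terms, each leg contributing its own
  squared coefficient of variation over its own sample size.

Scope / NOT CLAIMED: fixed ratio `a : b` only; independent evolutions; fixed statistic `α`; no
studentized (plug-in) version in this file; no rate, no finite-`n` coverage, no value for any
concrete protocol.
-/

namespace Summit.Ventures.LatticeQCDFlow.Exactness.GeneralNCMC

open MeasureTheory ProbabilityTheory Set Filter Finset
open scoped ENNReal NNReal Topology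

variable {E : Type*} [MeasurableSpace E]

namespace CrooksPair

variable {Ω : Type*} [MeasurableSpace Ω]
variable {ν₀ ν₁ : Measure Ω} {κF κR : Kernel Ω E} {s e : E → Ω} {W : E → ℝ}
variable {Ω' : Type*} [MeasurableSpace Ω'] {P' : Measure Ω'} [IsProbabilityMeasure P']

/-- **Consistency of the two-sample estimator over blocks**: `R_n → e^{−ΔF}` almost surely. -/
theorem tendsto_twoSample_ratio_blocks_ae [IsFiniteMeasure ν₀] [IsFiniteMeasure ν₁]
    [IsMarkovKernel κF] [IsMarkovKernel κR] (h0 : ν₀ univ ≠ 0) (h1 : ν₁ univ ≠ 0)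
    (h : CrooksPair ν₀ ν₁ κF κR s e W) {α : E → ℝ} (hαm : Measurable α) (hαpos : ∀ ε, 0 < α ε)
    (hA2 : MemLp (fun ε => α ε * Real.exp (-W ε)) 2 (fwdPathLaw ν₀ κF))
    (hB2 : MemLp α 2 (fwdPathLaw ν₁ κR)) {ΔF : ℝ}
    (hΔF : Real.exp (-ΔF) = ((ν₀ univ)⁻¹ * ν₁ univ).toReal) {a b : ℕ} (ha : 0 < a) (hb : 0 < b) :
    haveI := isProbabilityMeasure_fwdPathLaw ν₀ h0 κF
    haveI := isProbabilityMeasure_fwdPathLaw ν₁ h1 κR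
    ∀ᵐ ω ∂(Measure.infinitePi fun _ : ℕ =>
        (Measure.pi fun _ : Fin a => fwdPathLaw ν₀ κF).prod (Measure.pi fun _ : Fin b => fwdPathLaw ν₁ κR)),
      Tendsto (fun n : ℕ =>
        (∑ k ∈ range n, ∑ l, α ((ω k).1 l) * Real.exp (-W ((ω k).1 l))) / (a * n) /
          ((∑ k ∈ range n, ∑ l, α ((ω k).2 l)) / (b * n))) atTop (𝓝 (Real.exp (-ΔF))) := by
  haveI := isProbabilityMeasure_fwdPathLaw ν₀ h0 κF
  haveI := isProbabilityMeasure_fwdPathLaw ν₁ h1 κR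
  set PF := fwdPathLaw ν₀ κF with hPF
  set PR := fwdPathLaw ν₁ κR with hPR
  set μF := Measure.pi fun _ : Fin a => PF with hμF
  set μR := Measure.pi fun _ : Fin b => PR with hμR
  set μ := μF.prod μR with hμ
  have hgm : Measurable fun ε => α ε * Real.exp (-W ε) :=
    hαm.mul (Real.measurable_exp.comp h.measurable_W.neg)
  have hfA : Measurable fun x : Fin a → E => ∑ l, α (x l) * Real.exp (-W (x l)) := measurable_blockSum hgm
  have hgB : Measurable fun y : Fin b → E => ∑ l, α (y l) := measurable_blockSum hαm
  have ham : Measurable fun p : (Fin a → E) × (Fin b → E) => ∑ l, α (p.1 l) * Real.exp (-W (p.1 l)) :=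
    hfA.comp measurable_fst
  have hbm : Measurable fun p : (Fin a → E) × (Fin b → E) => ∑ l, α (p.2 l) := hgB.comp measurable_snd
  have hfA2 : MemLp (fun x : Fin a → E => ∑ l, α (x l) * Real.exp (-W (x l))) 2 μF :=
    memLp_blockSum PF hA2
  have hgB2 : MemLp (fun y : Fin b → E => ∑ l, α (y l)) 2 μR := memLp_blockSum PR hB2
  have ha1 : Integrable (fun p : (Fin a → E) × (Fin b → E) => ∑ l, α (p.1 l) * Real.exp (-W (p.1 l))) μ :=
    (hfA2.comp_measurePreserving (measurePreserving_fst (μ := μF) (ν := μR))).integrable one_le_two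
  have hb1 : Integrable (fun p : (Fin a → E) × (Fin b → E) => ∑ l, α (p.2 l)) μ :=
    (hgB2.comp_measurePreserving (measurePreserving_snd (μ := μF) (ν := μR))).integrable one_le_two
  set mA := ∫ ε, α ε * Real.exp (-W ε) ∂PF with hmA
  set mB := ∫ ε, α ε ∂PR with hmB
  have hia : ∫ p, ∑ l, α (p.1 l) * Real.exp (-W (p.1 l)) ∂μ = a * mA := by
    rw [integral_comp_of_measurePreserving (measurePreserving_fst (μ := μF) (ν := μR))
      (hfA2.integrable one_le_two).aestronglyMeasurable, hmA]
    exact integral_blockSum PF (hA2.integrable one_le_two)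
  have hib : ∫ p, ∑ l, α (p.2 l) ∂μ = b * mB := by
    rw [integral_comp_of_measurePreserving (measurePreserving_snd (μ := μF) (ν := μR))
      (hgB2.integrable one_le_two).aestronglyMeasurable, hmB]
    exact integral_blockSum PR (hB2.integrable one_le_two)
  have hB : 0 < mB := by
    rw [hmB, integral_pos_iff_support_of_nonneg (fun ε => (hαpos ε).le) (hB2.integrable one_le_two)]
    have hsupp : Function.support α = univ := by
      ext ε
      simp only [Function.mem_support, mem_univ, iff_true]
      exact (hαpos ε).ne'
    rw [hsupp, measure_univ]
    exact one_pos
  have htwo : mA = Real.exp (-ΔF) * mB := by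
    have := h.integral_exp_neg_work_mul h0 h1 hΔF α
    rw [hmA, hmB, ← this]
    refine integral_congr_ae (Eventually.of_forall fun ε => ?_)
    simp only
    ring
  have ha' : (a : ℝ) ≠ 0 := by exact_mod_cast ha.ne'
  have hb' : (b : ℝ) ≠ 0 := by exact_mod_cast hb.ne'
  filter_upwards [tendsto_sampleMean_ae μ ham ha1, tendsto_sampleMean_ae μ hbm hb1] with ω hωa hωb
  rw [hia] at hωa
  rw [hib] at hωb
  have hlim : Tendsto (fun n : ℕ =>
      sampleMean (fun p : (Fin a → E) × (Fin b → E) => ∑ l, α (p.1 l) * Real.exp (-W (p.1 l)))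
          (fun i : Fin n => ω i) / a /
        (sampleMean (fun p : (Fin a → E) × (Fin b → E) => ∑ l, α (p.2 l)) (fun i : Fin n => ω i) / b))
      atTop (𝓝 (Real.exp (-ΔF))) := by
    have key := (hωa.div_const (a : ℝ)).div (hωb.div_const (b : ℝ))
      (div_ne_zero (mul_ne_zero hb' hB.ne') hb')
    have hval : (a : ℝ) * mA / a / (b * mB / b) = Real.exp (-ΔF) := by
      rw [htwo]
      field_simp
    rw [hval] at key
    exact key
  refine hlim.congr' ?_
  filter_upwards [eventually_gt_atTop 0] with n hn
  have hn' : (n : ℝ) ≠ 0 := by exact_mod_cast hn.ne'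
  unfold sampleMean
  rw [Fin.sum_univ_eq_sum_range (fun k => ∑ l, α ((ω k).1 l) * Real.exp (-W ((ω k).1 l))) n,
    Fin.sum_univ_eq_sum_range (fun k => ∑ l, α ((ω k).2 l)) n]
  congr 1
  · rw [div_div, mul_comm (n : ℝ) (a : ℝ)]
  · rw [div_div, mul_comm (n : ℝ) (b : ℝ)]

/-- **Asymptotic normality of the two-sample free-energy estimate with sample-size ratio `a : b`.**
With `ΔF̂_n = −log R_n` the estimate from `a·n` forward and `b·n` reverse independent evolutions,
`√n (ΔF̂_n − ΔF) →d N(0, V_{a,b}(α))`,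
`V_{a,b}(α) = (E_F[(α e^{−W})²]/E_F[α e^{−W}]² − 1)/a + (E_R[α²]/E_R[α]² − 1)/b` — Bennett's variance
functional at `nf = a`, `nr = b`. -/
theorem tendstoInDistribution_twoSample_freeEnergy_blocks [IsFiniteMeasure ν₀] [IsFiniteMeasure ν₁]
    [IsMarkovKernel κF] [IsMarkovKernel κR] (h0 : ν₀ univ ≠ 0) (h1 : ν₁ univ ≠ 0)
    (h : CrooksPair ν₀ ν₁ κF κR s e W) {α : E → ℝ} (hαm : Measurable α) (hαpos : ∀ ε, 0 < α ε)
    (hA2 : MemLp (fun ε => α ε * Real.exp (-W ε)) 2 (fwdPathLaw ν₀ κF))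
    (hB2 : MemLp α 2 (fwdPathLaw ν₁ κR)) {ΔF : ℝ}
    (hΔF : Real.exp (-ΔF) = ((ν₀ univ)⁻¹ * ν₁ univ).toReal) {a b : ℕ} (ha : 0 < a) (hb : 0 < b)
    {Y : Ω' → ℝ}
    (hY : HasLaw Y (gaussianReal 0
      ((((∫ ε, (α ε * Real.exp (-W ε)) ^ 2 ∂(fwdPathLaw ν₀ κF)) /
          (∫ ε, α ε * Real.exp (-W ε) ∂(fwdPathLaw ν₀ κF)) ^ 2 - 1) / a +
        ((∫ ε, α ε ^ 2 ∂(fwdPathLaw ν₁ κR)) / (∫ ε, α ε ∂(fwdPathLaw ν₁ κR)) ^ 2 - 1) / b)).toNNReal) P') :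
    haveI := isProbabilityMeasure_fwdPathLaw ν₀ h0 κF
    haveI := isProbabilityMeasure_fwdPathLaw ν₁ h1 κR
    TendstoInDistribution
      (fun (n : ℕ) (ω : ℕ → (Fin a → E) × (Fin b → E)) => √(n : ℝ) *
        (-Real.log ((∑ k ∈ range n, ∑ l, α ((ω k).1 l) * Real.exp (-W ((ω k).1 l))) / (a * n) /
          ((∑ k ∈ range n, ∑ l, α ((ω k).2 l)) / (b * n))) - ΔF))
      atTop Y (fun _ => Measure.infinitePi fun _ : ℕ =>
        (Measure.pi fun _ : Fin a => fwdPathLaw ν₀ κF).prod (Measure.pi fun _ : Fin b => fwdPathLaw ν₁ κR))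
      P' := by
  haveI := isProbabilityMeasure_fwdPathLaw ν₀ h0 κF
  haveI := isProbabilityMeasure_fwdPathLaw ν₁ h1 κR
  set μ := (Measure.pi fun _ : Fin a => fwdPathLaw ν₀ κF).prod
    (Measure.pi fun _ : Fin b => fwdPathLaw ν₁ κR) with hμ
  set θ := Real.exp (-ΔF) with hθdef
  have hθ : 0 < θ := Real.exp_pos _
  set V := ((∫ ε, (α ε * Real.exp (-W ε)) ^ 2 ∂(fwdPathLaw ν₀ κF)) /
          (∫ ε, α ε * Real.exp (-W ε) ∂(fwdPathLaw ν₀ κF)) ^ 2 - 1) / a +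
        ((∫ ε, α ε ^ 2 ∂(fwdPathLaw ν₁ κR)) / (∫ ε, α ε ∂(fwdPathLaw ν₁ κR)) ^ 2 - 1) / b with hV
  -- `V ≥ 0`: each bracket is `Var/mean² ≥ 0`
  have hB : 0 < ∫ ε, α ε ∂(fwdPathLaw ν₁ κR) := by
    rw [integral_pos_iff_support_of_nonneg (fun ε => (hαpos ε).le) (hB2.integrable one_le_two)]
    have hsupp : Function.support α = univ := by
      ext ε
      simp only [Function.mem_support, mem_univ, iff_true]
      exact (hαpos ε).ne'
    rw [hsupp, measure_univ]
    exact one_pos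
  have htwo : ∫ ε, α ε * Real.exp (-W ε) ∂(fwdPathLaw ν₀ κF) =
      Real.exp (-ΔF) * ∫ ε, α ε ∂(fwdPathLaw ν₁ κR) := by
    have := h.integral_exp_neg_work_mul h0 h1 hΔF α
    rw [← this]
    refine integral_congr_ae (Eventually.of_forall fun ε => ?_)
    simp only
    ring
  have hV0 : 0 ≤ V := by
    have h1' : 0 ≤ (∫ ε, (α ε * Real.exp (-W ε)) ^ 2 ∂(fwdPathLaw ν₀ κF)) /
        (∫ ε, α ε * Real.exp (-W ε) ∂(fwdPathLaw ν₀ κF)) ^ 2 - 1 := by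
      have hv := variance_nonneg (fun ε => α ε * Real.exp (-W ε)) (fwdPathLaw ν₀ κF)
      rw [variance_eq_sub hA2] at hv
      simp only [Pi.pow_apply] at hv
      have hpos : 0 < (∫ ε, α ε * Real.exp (-W ε) ∂(fwdPathLaw ν₀ κF)) ^ 2 := by
        rw [htwo]
        positivity
      rw [sub_nonneg, le_div_iff₀ hpos, one_mul]
      linarith
    have h2' : 0 ≤ (∫ ε, α ε ^ 2 ∂(fwdPathLaw ν₁ κR)) / (∫ ε, α ε ∂(fwdPathLaw ν₁ κR)) ^ 2 - 1 := by
      have hv := variance_nonneg α (fwdPathLaw ν₁ κR)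
      rw [variance_eq_sub hB2] at hv
      simp only [Pi.pow_apply] at hv
      have hpos : 0 < (∫ ε, α ε ∂(fwdPathLaw ν₁ κR)) ^ 2 := by positivity
      rw [sub_nonneg, le_div_iff₀ hpos, one_mul]
      linarith
    rw [hV]
    positivity
  -- the ratio CLT against `Y₀ = −θ·Y ~ N(0, θ² V)`
  have hY' : HasLaw Y (gaussianReal 0 (θ ^ 2 * V / θ ^ 2).toNNReal) P' := by
    rwa [mul_div_cancel_left₀ _ (pow_ne_zero 2 hθ.ne')]
  have hY₀ := hasLaw_const_mul_gaussianReal (v := θ ^ 2 * V) (by positivity) hθ.ne' (neg_sq θ) hY'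
  have hratioCLT := h.tendstoInDistribution_twoSample_ratio_blocks h0 h1 hαm hαpos hA2 hB2 hΔF ha hb hY₀
  have hae := h.tendsto_twoSample_ratio_blocks_ae h0 h1 hαm hαpos hA2 hB2 hΔF ha hb
  have hgm : Measurable fun ε => α ε * Real.exp (-W ε) :=
    hαm.mul (Real.measurable_exp.comp h.measurable_W.neg)
  have hRm : ∀ n, Measurable fun ω : ℕ → (Fin a → E) × (Fin b → E) =>
      (∑ k ∈ range n, ∑ l, α ((ω k).1 l) * Real.exp (-W ((ω k).1 l))) / (a * n) /
        ((∑ k ∈ range n, ∑ l, α ((ω k).2 l)) / (b * n)) := fun n =>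
    ((Finset.measurable_sum _ fun k _ =>
      (measurable_blockSum hgm).comp (measurable_fst.comp (measurable_pi_apply k))).div_const _).div
      ((Finset.measurable_sum _ fun k _ =>
        (measurable_blockSum hαm).comp (measurable_snd.comp (measurable_pi_apply k))).div_const _)
  have hlog := tendstoInDistribution_sqrt_mul_log_sub hθ hRm hae hratioCLT
  have hlim : (fun ω' => θ⁻¹ * (-θ * Y ω')) = fun ω' => -Y ω' := by
    funext ω'
    field_simp
  rw [hlim] at hlog
  have hneg := hlog.continuous_comp (g := fun x : ℝ => -x) (by fun_prop)
  simp only [Function.comp_def, neg_neg] at hneg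
  convert hneg using 3 with n ω
  rw [hθdef, Real.log_exp]
  ring

end CrooksPair

end Summit.Ventures.LatticeQCDFlow.Exactness.GeneralNCMC
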